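import Mathlib
import HarnessLib
import Summits.CriticalPhenomena.Ising3DConformalLimit.Theses.MirrorHoelderCompactness
import Summits.CriticalPhenomena.Ising3DConformalLimit.Theorems.HyperoctahedralRPExistsScaleCovariantLimitNonSeparableModulusOfUniformRegularity
import Summits.CriticalPhenomena.Ising3DConformalLimit.Theorems.HyperoctahedralRPExistsScaleCovariantLimitCompactnessItemMapsDoubling
import Summits.CriticalPhenomena.Ising3DConformalLimit.Theorems.MoebiusLimitExists.Negative.PinnedClusterPoints

/-!
# Crux `NonSeparableModulus` (stmt-CriticalPhenomena-6152) — birth skeleton: the scale-splitting line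

Route `MirrorHoelderCompactness` (also wanted by `MonotoneBlocking`), crux rank 4. `NonSeparableModulus`
(NS) asks for asymptotic equicontinuity, uniformly in the mesh `δ ∈ (0, δ₀)`, of the PINNED critical
`ℤ³` Ising zoom `F_n^δ = rescaledCorrelator (criticalCorr 3) ρ★ n δ`,
`ρ★(δ) = ⟨σ₀σ_{⌊δ⁻¹⌋e₀}⟩_{β_c}^{-1/2}`, under ONE-point moves `x ↦ update x i y` at the configurations
of a compact `K ⊆ NonCoincident 3 n` whose moving point is NOT `m`-separable by any of the nine
lattice mirror normals (the "caged" complement of the proved `SeparableHoelder`, item 6151).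

STATE OF THE TREE (2026-08-17), recorded because it decides what an honest line is:
`NS ⟸ UniformRegularity (item 4658)` is landed (`stub_nonSeparableModulus_of_uniformRegularity`) and
`UniformRegularity ⟺ TwoPointDoubling (item 6150)` is landed (`uniformRegularity_iff_doubling`, the RP
"mirror pedigree" transport of pair regularity to all orders, lead c4/c5 of crux 1981): so **NS is
closed modulo the route's own rank-2 crux 6150** — the two-line remark
`NonSeparableModulus_of_twoPointDoubling` of §5 (after the registered line). Every known mechanism for NS pays for local bounds of
the pinned zoom at sub-unit scales, and that payment IS doubling.

THE LINE filed here isolates exactly where doubling enters. The EXACT lattice identity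
`F_n^δ(x) = (ρ★(δ)/ρ★(Λδ))ⁿ · F_n^{Λδ}(Λ • x)` (`⌊Λxₖ/(Λδ)⌋ = ⌊xₖ/δ⌋`: the same sites, re-read at the
coarser macroscopic scale `Λ`) splits NS into
* `stub_coarseScaleModulus` (size L, DOUBLING-FREE by design): every compact `K` of non-coincident
  configurations becomes asymptotically equicontinuous for the pinned zoom after a sufficiently large
  dilation `Λ ≥ Λ₀(n, K)` — at macroscopic scales `≥ Λ₀` all two-point inputs of the pedigree transport
  (local bounds `ρ★²G ≤ 1` beyond the pinning distance, the nine-mirror gradient estimate item 6156 at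
  arguments `s/8 ≥ ⌊δ⁻¹⌋`, the discarded-block bounds) follow from Messager–Miracle-Solé MONOTONICITY
  `g(m) ≤ g(⌊δ⁻¹⌋)` for `m ≥ ⌊δ⁻¹⌋` instead of doubling; the pedigree depth and margins are locally
  bounded on `K` (`pedigree_cover ∘ covering_all`), which fixes `Λ₀`;
* `stub_pinningRatioBound` (= the scalar doubling content): `ρ★(δ) ≤ C(Λ)·ρ★(Λδ)` for `δ < δ₀(Λ)`,
  i.e. `g(⌊(Λδ)⁻¹⌋) ≤ C² g(⌊δ⁻¹⌋)` — item 6150 `TwoPointDoubling` in mesh clothes (`Λ = 2 ↔ κ = C⁻²`,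
  modulo floors; `⟸ 6150` is M-sized bookkeeping with MMS monotonicity along the axis).
`NonSeparableModulus_of` (sorry-free): thicken `K` to a compact `K' ⊆ NonCoincident` (the update stays in
`K'`), dilate by `Λ := max Λ₀ 1`, transfer the modulus at mesh `Λδ` back to mesh `δ` through the
identity, paying the factor `(ρ★(δ)/ρ★(Λδ))ⁿ ≤ max(C,1)ⁿ`.

Why the cut is honest: neither stub alone reaches NS (the coarse modulus says nothing below scale `Λ₀`;
the ratio bound says nothing about `n`-point differences), neither is the summit, and the seam is the
genuine change-of-mesh identity, not `⟨h₁, h₂⟩`. Disproof.lean for this crux: none on file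
(`ledger crux ls stmt-CriticalPhenomena-6152`: no workfiles before this one); negatives index: no
statement about these moduli (9 CriticalPhenomena entries, SAW/percolation/Cardy).
-/

noncomputable section

namespace Summit.CriticalPhenomena.Ising3DConformalLimit.Cruxes.NonSeparableModulus.Birth

open Literature.Probability.LatticeModels Filter Set
open scoped Topology
open Summit.CriticalPhenomena.Ising3DConformalLimit.MoebiusLimitExistsOnlyInteraction (rhoPin)
open Summit.CriticalPhenomena.Ising3DConformalLimit.PinnedClusterPoints (criticalTwoPoint_pos3)
open Summit.CriticalPhenomena.Ising3DConformalLimit.Cruxes.ExistsScaleCovariantLimit.TwoHierarchies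
open Summit.CriticalPhenomena.Ising3DConformalLimit.Theses.MirrorHoelderCompactness

/-! ### §1 Lattice bookkeeping: re-reading the same sites at a coarser macroscopic scale -/

/-- `⌊Λ wₖ / (Λ δ)⌋ = ⌊wₖ / δ⌋`: dilating a point and the mesh by the same `Λ ≠ 0` does not change its
lattice approximation. [folklore] -/
theorem latticeApprox_smul {Λ : ℝ} (hΛ : Λ ≠ 0) (δ : ℝ) (w : EuclideanSpace ℝ (Fin 3)) :
    latticeApprox (Λ * δ) (Λ • w) = latticeApprox δ w := by
  funext k
  simp only [latticeApprox_apply, PiLp.smul_apply, smul_eq_mul]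
  rw [mul_div_mul_left _ _ hΛ]

/-- The rescaled correlator of the dilated configuration at the dilated mesh is the SAME lattice
correlator, renormalised at the dilated mesh:
`rescaledCorrelator G ρ n (Λδ) (Λ • z) = ρ(Λδ)ⁿ · G n (⌊z/δ⌋)`. [folklore] -/
theorem rescaledCorrelator_dilate (G : LatticeCorrFamily 3) (ρ : ℝ → ℝ) {Λ : ℝ} (hΛ : Λ ≠ 0)
    (n : ℕ) (δ : ℝ) (z : Fin n → EuclideanSpace ℝ (Fin 3)) :
    rescaledCorrelator G ρ n (Λ * δ) (Λ • z) = ρ (Λ * δ) ^ n * G n (fun i => latticeApprox δ (z i)) := by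
  simp only [rescaledCorrelator_apply, Pi.smul_apply, latticeApprox_smul hΛ]

/-- **Change of mesh.** For renormalisations with `ρ (Λδ) ≠ 0`:
`rescaledCorrelator G ρ n δ z = (ρ δ / ρ (Λδ))ⁿ · rescaledCorrelator G ρ n (Λδ) (Λ • z)`. [folklore] -/
theorem rescaledCorrelator_change_mesh (G : LatticeCorrFamily 3) (ρ : ℝ → ℝ) {Λ : ℝ} (hΛ : Λ ≠ 0)
    (n : ℕ) {δ : ℝ} (hρ : ρ (Λ * δ) ≠ 0) (z : Fin n → EuclideanSpace ℝ (Fin 3)) :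
    rescaledCorrelator G ρ n δ z =
      (ρ δ / ρ (Λ * δ)) ^ n * rescaledCorrelator G ρ n (Λ * δ) (Λ • z) := by
  rw [rescaledCorrelator_dilate G ρ hΛ, rescaledCorrelator_apply, ← mul_assoc, ← mul_pow,
    div_mul_cancel₀ _ hρ]

/-- `ρ_pin > 0` at every mesh (`⟨σ₀σ_w⟩_{β_c} > 0` on `ℤ³`). [folklore] -/
theorem rhoPin_pos' (δ : ℝ) : 0 < rhoPin δ :=
  Real.rpow_pos_of_pos (criticalTwoPoint_pos3 _) _

/-! ### §2 The stub statements, as named propositions -/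

/-- **Statement of stub 1 — COARSE-SCALE MODULUS (size L; doubling-free by design).** For every order
`n` and every compact `K ⊆ NonCoincident 3 n` there is a dilation threshold `Λ₀ > 0` such that for
every `Λ ≥ Λ₀` the pinned critical zoom is asymptotically equicontinuous on the dilated compact `Λ • K`,
uniformly in the mesh: `∀ ε > 0 ∃ r, δ₀ > 0 ∀ δ ∈ (0, δ₀) ∀ x, y ∈ K, dist x y < r →
|F_n^δ(Λ • x) − F_n^δ(Λ • y)| < ε`, `F_n^δ = rescaledCorrelator (criticalCorr 3) ρ★ n δ`,
`ρ★(δ) = ⟨σ₀σ_{⌊δ⁻¹⌋e₀}⟩^{-1/2}`. A consequence of item 4658 (take the compact `Λ • K`), hence of 6150;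
the point of the stub is that it should hold WITHOUT doubling: at macroscopic scales `≥ Λ₀` every
two-point size factor of the mirror-pedigree transport (`ρ★(δ)² G(z) ≤ 1` for `‖z‖_∞ ≥ ⌊δ⁻¹⌋`, the
nine-mirror gradient bound item 6156 with `⌊s/8⌋ ≥ ⌊δ⁻¹⌋`, Newman pairing for the discarded blocks) is
bounded by MMS monotonicity of the axial two-point function alone. -/
def CoarseScaleModulus : Prop :=
  ∀ (n : ℕ) (K : Set (Fin n → EuclideanSpace ℝ (Fin 3))), K ⊆ NonCoincident 3 n → IsCompact K →
    ∃ Λ₀ : ℝ, 0 < Λ₀ ∧ ∀ Λ : ℝ, Λ₀ ≤ Λ → ∀ ε : ℝ, 0 < ε → ∃ r δ₀ : ℝ, 0 < r ∧ 0 < δ₀ ∧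
      ∀ δ ∈ Set.Ioo 0 δ₀, ∀ x ∈ K, ∀ y ∈ K, dist x y < r →
        |rescaledCorrelator (criticalCorr 3)
            (fun δ : ℝ => (criticalTwoPoint 3 (Pi.single 0 ⌊δ⁻¹⌋)) ^ (-(1/2:ℝ))) n δ (Λ • x) -
          rescaledCorrelator (criticalCorr 3)
            (fun δ : ℝ => (criticalTwoPoint 3 (Pi.single 0 ⌊δ⁻¹⌋)) ^ (-(1/2:ℝ))) n δ (Λ • y)| < ε

/-- **Statement of stub 2 — PINNING-RATIO BOUND (the scalar doubling content; = item 6150 in mesh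
clothes).** For every dilation `Λ ≥ 1` there are `C, δ₀ > 0` with `ρ★(δ) ≤ C · ρ★(Λδ)` for all
`δ ∈ (0, δ₀)`, i.e. `⟨σ₀σ_{⌊(Λδ)⁻¹⌋e₀}⟩ ≤ C² ⟨σ₀σ_{⌊δ⁻¹⌋e₀}⟩`: reading the lattice at a macroscopic
scale `Λ` times coarser costs at most a constant in the pinned normalisation. At `Λ = 2` this is
all-scale axis doubling `κ g(n) ≤ g(2n)` (item 6150, `κ = C⁻²`) modulo floors, and 6150 gives every `Λ`
by iterating over `⌈log₂ Λ⌉` octaves with MMS monotonicity — open exactly as 6150 is (ADC21 Remark 5.10: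
regular scales only in abundance). -/
def PinningRatioBound : Prop :=
  ∀ Λ : ℝ, 1 ≤ Λ → ∃ C δ₀ : ℝ, 0 < δ₀ ∧ ∀ δ ∈ Set.Ioo 0 δ₀,
    (criticalTwoPoint 3 (Pi.single 0 ⌊δ⁻¹⌋)) ^ (-(1/2:ℝ)) ≤
      C * (criticalTwoPoint 3 (Pi.single 0 ⌊(Λ * δ)⁻¹⌋)) ^ (-(1/2:ℝ))

/-! ### §3 The registered stubs (the only `sorry`s of this file) -/

/-- stub 1 (size L, doubling-free by design; HARDEST of the line's own work): coarse-scale modulus. -/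
theorem stub_coarseScaleModulus : CoarseScaleModulus := by
  sorry

/-- stub 2 (= item 6150 in mesh clothes; open-problem): pinning-ratio bound. -/
theorem stub_pinningRatioBound : PinningRatioBound := by
  sorry

/-! ### Name-keyed aliases of the stub statements (the hypotheses of the composition) -/
namespace Registered

/-- Alias of `CoarseScaleModulus` keyed by the registered stub name. -/
abbrev stub_coarseScaleModulus : Prop := CoarseScaleModulus
/-- Alias of `PinningRatioBound` keyed by the registered stub name. -/
abbrev stub_pinningRatioBound : Prop := PinningRatioBound

end Registered

/-! ### §4 The composition: the two stubs give the crux, BY NAME -/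

/-- **`NonSeparableModulus` from the scale-splitting line.** Thicken `K` to a compact
`K' = cthickening η₀ K ⊆ NonCoincident 3 n` (so that `update x i y ∈ K'` once `‖y − x i‖ ≤ η₀`), take
the dilation threshold `Λ₀` of `K'` from stub 1 and `Λ := max Λ₀ 1`, the constant `C` of stub 2 at `Λ`,
and the modulus of stub 1 at `Λ` for `ε / max(C,1)ⁿ`; then for `δ < min δ₁ (δ₂/Λ)` the change-of-mesh
identity `F_n^δ(z) = (ρ★(δ)/ρ★(Λδ))ⁿ F_n^{Λδ}(Λ • z)` and `0 < ρ★(δ)/ρ★(Λδ) ≤ max(C,1)` transfer the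
modulus at mesh `Λδ` on `Λ • K'` to mesh `δ` on `K'`. The separability hypothesis is not used
(`m := 1`). Hypotheses = exactly the two registered stubs. -/
theorem NonSeparableModulus_of (h1 : Registered.stub_coarseScaleModulus)
    (h2 : Registered.stub_pinningRatioBound) :
    Summit.CriticalPhenomena.Ising3DConformalLimit.Theses.MirrorHoelderCompactness.NonSeparableModulus := by
  dsimp only [Registered.stub_coarseScaleModulus, Registered.stub_pinningRatioBound,
    CoarseScaleModulus, PinningRatioBound] at h1 h2
  intro n K hKs hK ε hε
  rw [rhoStar_eq_rhoPin] at h1 ⊢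
  -- a compact thickening inside the non-coincident configurations
  obtain ⟨η₀, hη₀, hK'c, hK's⟩ := exists_compact_cthickening_subset_nonCoincident hKs hK
  -- stub 1 on the thickening: the dilation threshold
  obtain ⟨Λ₀, hΛ₀, hmod⟩ := h1 n (Metric.cthickening η₀ K) hK's hK'c
  set Λ : ℝ := max Λ₀ 1 with hΛdef
  have hΛ1 : 1 ≤ Λ := le_max_right _ _
  have hΛpos : 0 < Λ := lt_of_lt_of_le one_pos hΛ1
  have hΛne : Λ ≠ 0 := hΛpos.ne'
  -- stub 2 at `Λ`: the pinning ratio is bounded by `M := max C 1 ≥ 1`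
  obtain ⟨C, δ₁, hδ₁, hC⟩ := h2 Λ hΛ1
  set M : ℝ := max C 1 with hMdef
  have hM1 : 1 ≤ M := le_max_right _ _
  have hMpos : 0 < M := lt_of_lt_of_le one_pos hM1
  have hMn : 0 < M ^ n := pow_pos hMpos n
  -- stub 1 at `Λ` with `ε / M ^ n`
  obtain ⟨r, δ₂, hr, hδ₂, hmodΛ⟩ := hmod Λ (le_max_left _ _) (ε / M ^ n) (div_pos hε hMn)
  refine ⟨1, min η₀ r, min δ₁ (δ₂ / Λ), one_pos, lt_min hη₀ hr,
    lt_min hδ₁ (div_pos hδ₂ hΛpos), fun δ hδ x hx i y hy _ => ?_⟩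
  have hδpos : 0 < δ := hδ.1
  have hδ1 : δ ∈ Set.Ioo 0 δ₁ := ⟨hδpos, lt_of_lt_of_le hδ.2 (min_le_left _ _)⟩
  have hΛδ : Λ * δ ∈ Set.Ioo 0 δ₂ := by
    refine ⟨mul_pos hΛpos hδpos, ?_⟩
    have h' : δ < δ₂ / Λ := lt_of_lt_of_le hδ.2 (min_le_right _ _)
    calc Λ * δ < Λ * (δ₂ / Λ) := mul_lt_mul_of_pos_left h' hΛpos
      _ = δ₂ := mul_div_cancel₀ _ hΛne
  -- the moved configuration stays in the thickening, within `r` of `x`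
  have hd : dist (Function.update x i y) x ≤ ‖y - x i‖ := dist_update_le_norm_sub x i y
  have hmem : Function.update x i y ∈ Metric.cthickening η₀ K :=
    Metric.mem_cthickening_of_dist_le _ x _ K hx (hd.trans (hy.le.trans (min_le_left _ _)))
  have hxK' : x ∈ Metric.cthickening η₀ K := Metric.self_subset_cthickening K hx
  have hdist : dist (Function.update x i y) x < r := hd.trans_lt (hy.trans_le (min_le_right _ _))
  -- the modulus at the coarse mesh `Λδ` on `Λ • K'`
  have hcoarse := hmodΛ (Λ * δ) hΛδ (Function.update x i y) hmem x hxK' hdist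
  -- the pinning ratio `t = ρ★(δ)/ρ★(Λδ) ∈ (0, M]`
  have hρΛ : 0 < rhoPin (Λ * δ) := rhoPin_pos' _
  have hρδ : 0 < rhoPin δ := rhoPin_pos' _
  have hCδ : rhoPin δ ≤ C * rhoPin (Λ * δ) := by
    have := hC δ hδ1
    simpa only [rhoPin, one_div] using this
  have ht0 : 0 < rhoPin δ / rhoPin (Λ * δ) := div_pos hρδ hρΛ
  have htM : rhoPin δ / rhoPin (Λ * δ) ≤ M := by
    rw [div_le_iff₀ hρΛ]
    exact hCδ.trans (mul_le_mul_of_nonneg_right (le_max_left _ _) hρΛ.le)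
  have htn : (rhoPin δ / rhoPin (Λ * δ)) ^ n ≤ M ^ n := pow_le_pow_left₀ ht0.le htM n
  have htn0 : 0 ≤ (rhoPin δ / rhoPin (Λ * δ)) ^ n := pow_nonneg ht0.le n
  -- change of mesh for both configurations
  rw [rescaledCorrelator_change_mesh (criticalCorr 3) rhoPin hΛne n hρΛ.ne' (Function.update x i y),
    rescaledCorrelator_change_mesh (criticalCorr 3) rhoPin hΛne n hρΛ.ne' x, ← mul_sub, abs_mul,
    abs_of_nonneg htn0]
  calc (rhoPin δ / rhoPin (Λ * δ)) ^ n *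
        |rescaledCorrelator (criticalCorr 3) rhoPin n (Λ * δ) (Λ • Function.update x i y) -
          rescaledCorrelator (criticalCorr 3) rhoPin n (Λ * δ) (Λ • x)|
      ≤ M ^ n * |rescaledCorrelator (criticalCorr 3) rhoPin n (Λ * δ) (Λ • Function.update x i y) -
          rescaledCorrelator (criticalCorr 3) rhoPin n (Λ * δ) (Λ • x)| :=
        mul_le_mul_of_nonneg_right htn (abs_nonneg _)
    _ < M ^ n * (ε / M ^ n) := mul_lt_mul_of_pos_left hcoarse hMn
    _ = ε := mul_div_cancel₀ _ hMn.ne'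

/-- The crux from the registered stubs plugged in (closed modulo exactly `stub_coarseScaleModulus` and
`stub_pinningRatioBound`: the file's only `sorry`s feed it). -/
theorem NonSeparableModulus_proof :
    Summit.CriticalPhenomena.Ising3DConformalLimit.Theses.MirrorHoelderCompactness.NonSeparableModulus :=
  NonSeparableModulus_of stub_coarseScaleModulus stub_pinningRatioBound

/-! ### §5 Remark: the crux is closed modulo item 6150 (composition of landed theorems only) -/

/-- **NS ⟸ item 6150.** `TwoPointDoubling → NonSeparableModulus`, by the landed
`uniformRegularity_of_doubling` (items 6150 ⟹ 4658: pair Hölder modulus from doubling, then the RP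
mirror-pedigree transport of pair regularity to every order; crux 1981 lead c4/c5) and the landed
`stub_nonSeparableModulus_of_uniformRegularity` (4658 ⟹ 6152: clause (b) on a compact thickening).
Recorded here so that the route audit sees that NS is not load-bearing next to 6150; not part of the
registered line (its hypothesis is the route item 6150, not a stub). [folklore] -/
theorem NonSeparableModulus_of_twoPointDoubling (hD : TwoPointDoubling) : NonSeparableModulus :=
  stub_nonSeparableModulus_of_uniformRegularity (ItemMaps.uniformRegularity_of_doubling hD)

end Summit.CriticalPhenomena.Ising3DConformalLimit.Cruxes.NonSeparableModulus.Birth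

end
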